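import Mathlib
import Literature.NumberTheory.LFunctions.MertensFormula
import Literature.NumberTheory.LFunctions.Zhang2022.ToolkitSmoothEulerMajorant
import HarnessLib

/-!
# Toolkit: sums of a multiplicative majorant over `s`-factored numbers, and Euler products over a
# WINDOW of primes `y < q ≤ z`: `∏_{y<q≤z}(1 + k/q + g(q)) ≤ e^{G + 16k/log y}(log z/log y)^k`

Topic `Literature/NumberTheory/LFunctions/Zhang2022` (Landau–Siegel audit tree; verdict-neutral; ZHANG-L
discharge lane, WP16 helper toolkit, seat zl-w16-p4; companion of `ToolkitSmoothEulerMajorant`). The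
"rough-number" counterpart of the smooth-number summation device: in Y. Zhang, *Discrete mean
estimates and the Landau–Siegel zero*, arXiv:2211.02515v1 (2022) [Zhang2022LandauSiegel] — an
unrefereed manuscript under adjudication; nothing here bears on its Theorems 1–2 — the steps "the
terms with `n ∉ 𝒩(𝔮)` [i.e. with a prime factor `≥ D⁴`] contribute `≪ …`" (§16 (16.15) p. 94, typed
`Typed.Section16B.Inline16_nsetRemovable`; §15 p. 87, §15.u050) sum a multiplicative majorant over
integers all of whose prime factors lie in a window `D⁴ ≤ q < T`, where the Euler product is only
`≍ (log T/log D⁴)^k = 𝓛^{0.1k}` up to constants. PROVED here (theorems only; no definitions, no named facts):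

* `sum_factored_multMajorant_div_le_prod` — for local weights `a(q,r) ≥ 0` with `Σ_r a(q,r)q^{−r}`
  convergent at every prime, and any finite set `A` of `s`-factored numbers (all prime factors in the
  finite set `s`), `Σ_{n∈A}(∏_{q^r∥n}a(q,r))/n ≤ ∏_{q∈s, q prime}(1 + Σ_{r≥1}a(q,r)/q^r)` (Mathlib's
  `EulerProduct.summable_and_hasSum_factoredNumbers_prod_filter_prime_tsum`);
* `sum_primes_window_inv_le` — `Σ_{y<q≤z} 1/q ≤ log log z − log log y + 8/log z + 8/log y` for
  `2 ≤ y ≤ z`, from the tree's Mertens formula with rate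
  `Literature.NumberTheory.LFunctions.Mertens.abs_primeRecipSum_sub_le`
  (`|Σ_{p≤x}1/p − log log x − B₁| ≤ 8/log x`);
* `prod_primes_window_one_add_le` — if `0 ≤ e(q) ≤ k/q + g(q)` on the primes `y < q ≤ z` and
  `Σ g ≤ G`, then `∏_{y<q≤z}(1 + e(q)) ≤ e^{G + 16k/log y}·(log z/log y)^k`.

## References

* R. R. Hall, G. Tenenbaum, *Divisors*, Cambridge Tracts in Math. 90 (1988), §0.2.
  [cite: HallTenenbaum1988, §0.2]
* G. H. Hardy, E. M. Wright, *An Introduction to the Theory of Numbers*, 6th ed., Thm 427 (Mertens,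
  with the Meissel–Mertens constant (22.8.1)). [cite: HardyWright2008, Thm 427]
* Y. Zhang, arXiv:2211.02515v1 (2022), §16 (16.15) p. 94; §15 p. 87. [cite: Zhang2022LandauSiegel, §16 (16.15) p.94]
-/

noncomputable section

open Real Finset
open Literature.NumberTheory.LFunctions.Mertens

namespace Literature.NumberTheory.LFunctions.Zhang2022.SmoothEulerMajorant

/-! ## Sums over `s`-factored numbers -/

/-- `M_a` (`M_a(n) := ∏_{q ∈ primeFactors n} a(q, v_q(n))`) is multiplicative on coprime arguments.
[folklore] -/
private theorem majorant_mul_of_coprime' (a : ℕ → ℕ → ℝ) {m n : ℕ} (h : Nat.Coprime m n) :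
    ∏ q ∈ (m * n).primeFactors, a q ((m * n).factorization q) =
      (∏ q ∈ m.primeFactors, a q (m.factorization q)) * ∏ q ∈ n.primeFactors, a q (n.factorization q) := by
  rcases eq_or_ne m 0 with rfl | hm
  · have hn : n = 1 := by simpa using h
    subst hn; simp
  rcases eq_or_ne n 0 with rfl | hn
  · have hm1 : m = 1 := by simpa using h
    subst hm1; simp
  rw [Nat.primeFactors_mul hm hn, Finset.prod_union h.disjoint_primeFactors]
  have hfac : (m * n).factorization = m.factorization + n.factorization := Nat.factorization_mul hm hn
  congr 1
  · refine Finset.prod_congr rfl fun q hq => ?_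
    have hq' : q ∉ n.primeFactors := Finset.disjoint_left.mp h.disjoint_primeFactors hq
    have h0 : n.factorization q = 0 := by
      rwa [← Finsupp.notMem_support_iff, Nat.support_factorization]
    rw [hfac, Finsupp.add_apply, h0, add_zero]
  · refine Finset.prod_congr rfl fun q hq => ?_
    have hq' : q ∉ m.primeFactors := Finset.disjoint_right.mp h.disjoint_primeFactors hq
    have h0 : m.factorization q = 0 := by
      rwa [← Finsupp.notMem_support_iff, Nat.support_factorization]
    rw [hfac, Finsupp.add_apply, h0, zero_add]

/-- `M_a(q^r) = a(q,r)` at a prime power, `r ≥ 1`. [folklore] -/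
private theorem majorant_prime_pow' (a : ℕ → ℕ → ℝ) {q : ℕ} (hq : q.Prime) {r : ℕ} (hr : r ≠ 0) :
    ∏ p ∈ (q ^ r).primeFactors, a p ((q ^ r).factorization p) = a q r := by
  rw [Nat.primeFactors_prime_pow hr hq, Finset.prod_singleton, Nat.Prime.factorization_pow hq,
    Finsupp.single_eq_same]

/-- **Sums of a multiplicative majorant over `s`-factored numbers**: for local weights `a(q,r) ≥ 0`
with `Σ_{r≥1}a(q,r)/q^r` convergent at every prime `q`, and any finite set `A` of `s`-factored positive
integers (all prime factors in the finite set `s`),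
`Σ_{n∈A} (∏_{q^r∥n}a(q,r))/n ≤ ∏_{q∈s, q prime}(1 + Σ_{r≥1}a(q,r)/q^r)`.
[cite: HallTenenbaum1988, §0.2] -/
theorem sum_factored_multMajorant_div_le_prod {a : ℕ → ℕ → ℝ} (ha : ∀ q r, 0 ≤ a q r)
    (hsum : ∀ q : ℕ, q.Prime → Summable fun r : ℕ => a q (r + 1) / (q : ℝ) ^ (r + 1))
    {s : Finset ℕ} {A : Finset ℕ} (hA : ∀ n ∈ A, n ∈ Nat.factoredNumbers s) :
    ∑ n ∈ A, (∏ q ∈ n.primeFactors, a q (n.factorization q)) / n ≤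
      ∏ q ∈ s with q.Prime, (1 + ∑' r : ℕ, a q (r + 1) / (q : ℝ) ^ (r + 1)) := by
  classical
  set f : ℕ → ℝ := fun n => (∏ q ∈ n.primeFactors, a q (n.factorization q)) / n with hf
  have hf₁ : f 1 = 1 := by simp [hf]
  have hmul : ∀ {m n : ℕ}, Nat.Coprime m n → f (m * n) = f m * f n := by
    intro m n h
    simp only [hf]
    rw [majorant_mul_of_coprime' a h, Nat.cast_mul]
    rcases eq_or_ne m 0 with rfl | hm
    · simp
    rcases eq_or_ne n 0 with rfl | hn
    · simp
    field_simp
  have hf0 : ∀ n, 0 ≤ f n := fun n =>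
    div_nonneg (Finset.prod_nonneg fun q _ => ha q _) (Nat.cast_nonneg n)
  have hfpow : ∀ {q : ℕ}, q.Prime → ∀ r : ℕ, f (q ^ (r + 1)) = a q (r + 1) / (q : ℝ) ^ (r + 1) := by
    intro q hq r
    simp only [hf]
    rw [majorant_prime_pow' a hq (Nat.succ_ne_zero r), Nat.cast_pow]
  have hloc : ∀ {q : ℕ}, q.Prime → Summable fun r : ℕ => ‖f (q ^ r)‖ := by
    intro q hq
    have h1 : Summable fun r : ℕ => ‖f (q ^ (r + 1))‖ := by
      refine (hsum q hq).norm.congr fun r => ?_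
      rw [hfpow hq]
    exact (summable_nat_add_iff 1).mp h1
  obtain ⟨-, hH⟩ :=
    EulerProduct.summable_and_hasSum_factoredNumbers_prod_filter_prime_tsum hf₁ hmul hloc s
  have htsum : ∀ q ∈ s.filter Nat.Prime,
      ∑' r : ℕ, f (q ^ r) = 1 + ∑' r : ℕ, a q (r + 1) / (q : ℝ) ^ (r + 1) := by
    intro q hq
    have hqp : q.Prime := (Finset.mem_filter.mp hq).2
    have hs' : Summable fun r : ℕ => f (q ^ r) := (hloc hqp).of_norm
    rw [hs'.tsum_eq_zero_add, pow_zero, hf₁]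
    congr 1
    exact tsum_congr fun r => hfpow hqp r
  rw [← Finset.prod_congr rfl htsum]
  have hle : ∑ n ∈ A, f n ≤ ∏ p ∈ s with p.Prime, ∑' n : ℕ, f (p ^ n) := by
    set A' : Finset (Nat.factoredNumbers s) := A.subtype (· ∈ Nat.factoredNumbers s) with hA'
    have hsumA : ∑ n ∈ A, f n = ∑ m ∈ A', f (m : ℕ) := by
      rw [hA', Finset.sum_subtype_eq_sum_filter, Finset.filter_true_of_mem hA]
    rw [hsumA]
    exact sum_le_hasSum A' (fun m _ => hf0 m) hH
  simpa [hf] using hle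

/-! ## Mertens over a window of primes -/

/-- **`Σ_{y<q≤z, q prime} 1/q ≤ log log z − log log y + 8/log z + 8/log y`** for naturals `2 ≤ y ≤ z`
(the tree's Mertens formula with rate `|Σ_{p≤x}1/p − log log x − B₁| ≤ 8/log x`, at `x = z` and
`x = y`). [cite: HardyWright2008, Thm 427] -/
theorem sum_primes_window_inv_le {y z : ℕ} (hy : 2 ≤ y) (hyz : y ≤ z) :
    ∑ q ∈ Nat.primesLE z \ Nat.primesLE y, (1 : ℝ) / q ≤
      Real.log (Real.log z) - Real.log (Real.log y) + 8 / Real.log z + 8 / Real.log y := by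
  have hsub : Nat.primesLE y ⊆ Nat.primesLE z := by
    intro q hq
    rw [Nat.mem_primesLE] at hq ⊢
    exact ⟨hq.1.trans hyz, hq.2⟩
  have hdiff : ∑ q ∈ Nat.primesLE z \ Nat.primesLE y, (1 : ℝ) / q =
      primeRecipSum z - primeRecipSum y := by
    rw [primeRecipSum, primeRecipSum, Nat.floor_natCast, Nat.floor_natCast,
      ← Finset.sum_sdiff hsub]
    simp [one_div]
  have hz2 : (2 : ℝ) ≤ z := by exact_mod_cast hy.trans hyz
  have hy2 : (2 : ℝ) ≤ y := by exact_mod_cast hy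
  have h1 := abs_le.mp (abs_primeRecipSum_sub_le hz2)
  have h2 := abs_le.mp (abs_primeRecipSum_sub_le hy2)
  rw [hdiff]
  linarith [h1.2, h2.1]

/-- **Euler products over a window of primes**: for naturals `2 ≤ y ≤ z`, `k ∈ ℕ`, and
`0 ≤ e(q) ≤ k/q + g(q)` at the primes `y < q ≤ z` with `Σ g ≤ G`,
`∏_{y<q≤z}(1 + e(q)) ≤ e^{G + 16k/log y}·(log z/log y)^k` (`1 + x ≤ eˣ`, `sum_primes_window_inv_le`,
`8/log z ≤ 8/log y`, `exp(k(log log z − log log y)) = (log z/log y)^k`). [cite: HardyWright2008, Thm 427] -/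
theorem prod_primes_window_one_add_le {y z : ℕ} (hy : 2 ≤ y) (hyz : y ≤ z) (k : ℕ) {G : ℝ}
    {e g : ℕ → ℝ} (he0 : ∀ q ∈ Nat.primesLE z \ Nat.primesLE y, 0 ≤ e q)
    (he : ∀ q ∈ Nat.primesLE z \ Nat.primesLE y, e q ≤ (k : ℝ) / q + g q)
    (hG : ∑ q ∈ Nat.primesLE z \ Nat.primesLE y, g q ≤ G) :
    ∏ q ∈ Nat.primesLE z \ Nat.primesLE y, (1 + e q) ≤
      Real.exp (G + 16 * k / Real.log y) * (Real.log z / Real.log y) ^ k := by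
  set s := Nat.primesLE z \ Nat.primesLE y with hs
  have hlogy : 0 < Real.log y := Real.log_pos (by exact_mod_cast (show 1 < y by omega))
  have hlogz : 0 < Real.log z := Real.log_pos (by exact_mod_cast (show 1 < z by omega))
  have hlogyz : Real.log y ≤ Real.log z :=
    Real.log_le_log (by exact_mod_cast (show 0 < y by omega)) (by exact_mod_cast hyz)
  have h1 : ∏ q ∈ s, (1 + e q) ≤ Real.exp (∑ q ∈ s, e q) := by
    rw [Real.exp_sum]
    exact Finset.prod_le_prod (fun q hq => by linarith [he0 q hq]) fun q _ => by
      linarith [Real.add_one_le_exp (e q)]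
  have hW := sum_primes_window_inv_le hy hyz
  have h8 : 8 / Real.log z ≤ 8 / Real.log y := div_le_div_of_nonneg_left (by norm_num) hlogy hlogyz
  have h2 : ∑ q ∈ s, e q ≤
      (k : ℝ) * (Real.log (Real.log z) - Real.log (Real.log y)) + (G + 16 * k / Real.log y) := by
    calc ∑ q ∈ s, e q ≤ ∑ q ∈ s, ((k : ℝ) / q + g q) := Finset.sum_le_sum he
      _ = (k : ℝ) * ∑ q ∈ s, (1 : ℝ) / q + ∑ q ∈ s, g q := by
          rw [Finset.sum_add_distrib, Finset.mul_sum]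
          congr 1
          exact Finset.sum_congr rfl fun q _ => by ring
      _ ≤ (k : ℝ) * (Real.log (Real.log z) - Real.log (Real.log y) + 8 / Real.log z + 8 / Real.log y) +
            G := by gcongr
      _ ≤ (k : ℝ) * (Real.log (Real.log z) - Real.log (Real.log y)) + (G + 16 * k / Real.log y) := by
          have hk : (0 : ℝ) ≤ k := Nat.cast_nonneg k
          have : (k : ℝ) * (8 / Real.log z + 8 / Real.log y) ≤ 16 * k / Real.log y := by
            rw [show 16 * (k : ℝ) / Real.log y = k * (8 / Real.log y + 8 / Real.log y) by ring]
            exact mul_le_mul_of_nonneg_left (by linarith) hk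
          linarith
  calc ∏ q ∈ s, (1 + e q) ≤ Real.exp (∑ q ∈ s, e q) := h1
    _ ≤ Real.exp ((k : ℝ) * (Real.log (Real.log z) - Real.log (Real.log y)) +
          (G + 16 * k / Real.log y)) := Real.exp_le_exp.mpr h2
    _ = Real.exp (G + 16 * k / Real.log y) * (Real.log z / Real.log y) ^ k := by
        rw [Real.exp_add, mul_comm, Real.exp_nat_mul, Real.exp_sub, Real.exp_log hlogz,
          Real.exp_log hlogy]

end Literature.NumberTheory.LFunctions.Zhang2022.SmoothEulerMajorant

end
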